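import Summits.QuantumFields.BalabanUV.Beta.GAN24.BornBorderContactPairLineage
import Summits.QuantumFields.BalabanUV.Beta.GAN24.BornBorderContactPairTent
import Summits.QuantumFields.BalabanUV.Beta.GAN24.BornLambdaDriftSup

/-!
# `BalabanUV.Beta.GAN24.BornBorderContactPairBound` — binder row G-an2-4 / (CONV-C), CT-ROUTE, «(V-C)-DIFF» module (D), THE END: **THE CONTACT V PAIR LETTER OF THE BORN-V RATE HALF**
# at `d = 3`, `2 ≤ Lc`, pin `|cE| ≤ Lc^4`, every scale `cVH`, uniformly in the in-block root — the top-aligned pair of `BornBorderContactBound.exists_hCgV_three`'s object,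
# `LocStencil ((D_{i+1,k+1} − U_{i+1,k+1}) − (D_{i,k} − U_{i,k})) (C·((k−i)^1·Θ^k)) δ` for ALL `i < k`, and leaf-04 g57's `hPcV` binder of `BornBorderDriftAssembly.exists_hBdevV_three_of_contactPairs`
# (sup currency, births `≥ 1`, `q = 1`) CHARACTER FOR CHARACTER

NOT IN PRINT; OUR BOOKKEEPING (G-an2-4 formalisation swarm → CRUX TEAM (2), leaf prover `b2b-balaban-gan24-formalise-leaf-03`, gen 56; «(V-C)-DIFF» INTENT journal `CLAIMS.log`
[LEAF03-G56-ONLINE] ∕ [LEAF03-G56-A1]; leaf-04 g57's A1 to «ROOTED-S3-V-DIFF» names the binder).  OUR PROOF ATTEMPT of the V twin of leaf-01 g61's BORN-CONTACT-DIFF-PLAN v0, assembled: (C1)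
`BornBorderContactNest.contact_v_eq_of_top ∕ _of_succ` for BOTH members (same relative depth `n`, births `i` and `i+1`, SAME lattice), (C) `BornBorderContactPairLineage` for the weighted pair,
and the TREE letters — leaf-12∕14's `RespStepDecay.exists_respStep_decay_and_grad` ((N1)), the OWNER gan24-p1's CT-4a `RespStepCauchy.exists_respStep_cauchy` (the undressed-leg pair AND,
through gan24-p2 g34's CT-4b Pack §A `abs_gaugePieceSucc_le`, the differenced staircase pieces), leaf-01's `DressedLegEnvelope.exists_legChain_envelope`, the wall's K-slot data
`KSlotAssembly.convCKWall_holds` (`hK` ⇒ the tents via (D⁻) `BornBorderContactBound` §1; `hKall` ⇒ the tent PAIRS via (D⁰) `BornBorderContactPairTent`, gan24-p2 g32's CT-4d `ContactTentCauchy.abs_unitTent_sub_le`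
read through leaf-01 g61's `BornLambdaBracketPair` φ-trick).  `pair_cells_le_top ∕ _succ` (the two cases' letters plumbed into (C)),
`d = 3`.  0 `def`, 0 cited facts, 0 `def … : Prop`, 0 sorry.  HONEST FRAMING (cell contract, verbatim):
«discharging `BetaPertH` makes Bałaban's UV stability UNCONDITIONAL — a real milestone — but is NOT existence of continuum YM on T⁴ and NOT the Clay problem.»  This file proves the CONTACT
V pair letter and NOTHING ELSE: hBdev(cVH,0) of the comb family ⇐ (this) ∧ leaf-04 g57's «ROOTED-S3-V-DIFF» undressed pairs ∧ his sockets, as staged by him; NEVER «G-an2-4 closed»; NOT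
(hS, hSall), NOT (CONV-C), NOT D1, NOT `BetaPertH`.  HONEST DEPENDENCY: continuum YM on T⁴ ⇐ BetaPertH ∧ nine spine estimates (0/9 proved); BetaPertH ⇐ (D1) ∧ (D4) ∧ CAP+tail; G-an2-4
gates asym, D1 and NE2/3/4.

WHAT IS PROVED.
* §2 (`d = 3`; the tent pairs are (D⁰) `BornBorderContactPairTent`) `le_fold_rate` (real arithmetic: `(A₁θ₁^{i+n} + A₂θ₂^{i+n})·(n+1)·L^{n+1} ≤ (A₁+A₂)·(n+1)·Θ^{i+n+1}` for `θ₁, θ₂, L ≤ Θ`, `L ≤ 1`),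
  **`exists_hCgV_pair_three (hLc : 2 ≤ Lc) (cE cVH) (hcE : |cE| ≤ Lc^4) : ∃ C Θ δ, 0 ≤ C ∧ 0 ≤ Θ ∧ Θ < 1 ∧ 0 < δ ∧ ∀ rr ∈ box (3+1) Lc, ∀ k i, i < k →
  LocStencil ((D_{i+1,k+1} − U_{i+1,k+1}) − (D_{i,k} − U_{i,k})) (C·(((k−i:ℕ):ℝ)^1·Θ^k)) δ`** — `Θ = max (max θ_{4a} θ_K) Lc⁻¹`.
* §3 **`exists_hPcV_three (hLc : 2 ≤ Lc) (hcE : cE = Lc^(3+1)) (cVH)`** — leaf-04 g57's `hPcV` binder at `q = 1` VERBATIM (sup currency, births `1 ≤ i`): §2 with the decay forgotten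
  (leaf-06's `BornLambdaDriftSup.locStencil_zero_of_locStencil ∕ locStencil_zero_iff_supBound`).
-/

open scoped BigOperators
open Literature.MathematicalPhysics.QuantumFieldTheory
open Literature.MathematicalPhysics.QuantumFieldTheory.LatticeForm (quo)
open Literature.MathematicalPhysics.QuantumFieldTheory.Balaban1983to89
open Literature.MathematicalPhysics.QuantumFieldTheory.Balaban1983to89.Beta
open B4ContourShift (supNorm supNorm_nonneg)
open B12Sec2to5 (l1 l1_nonneg)
open ExpKernelCalculus (MKer Decays Zl Zl_nonneg)
open AffineAveraging (Form1 Site box toSite)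
open AveragingHessianKernels (ell)
open AveragingHessianKernelsRooted (vhSAt)
open OneStepResolventKernel (Fib LocStencil)
open BalabanCompositeJets (respStep)
open Summit.QuantumFields.BalabanUV.Beta.GAN24.CombesThomas (sfStep smStep KStepUnit UnitDecayK CauchyDecayK SupBound)
open Summit.QuantumFields.BalabanUV.Beta.GAN24.KSlotAssembly (convCKWall_holds)
open Summit.QuantumFields.BalabanUV.Beta.GAN24.Push4 (legComp)
open Summit.QuantumFields.BalabanUV.Beta.GAN24.Push4Bounds (LegDecay)
open Summit.QuantumFields.BalabanUV.Beta.GAN24.Push4Iter (legChain)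
open Summit.QuantumFields.BalabanUV.Beta.GAN24.Push3 (push₃)
open Summit.QuantumFields.BalabanUV.Beta.GAN24.AffineUnroll (transport)
open Summit.QuantumFields.BalabanUV.Beta.GAN24.RespStepBmDecompPsi (decays_KStepUnit_levels)
open Summit.QuantumFields.BalabanUV.Beta.GAN24.RespStepBmDecompExact (respStepBmSeq)
open Summit.QuantumFields.BalabanUV.Beta.GAN24.SrecLinearPartEq (colM rowMM reslot legDecay_colM legDecay_rowMM)
open Summit.QuantumFields.BalabanUV.Beta.GAN24.SrecBornSector (unitStepMap)
open Summit.QuantumFields.BalabanUV.Beta.GAN24.UndressedResponseUnits (inv_cast_pow_pow)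
open Summit.QuantumFields.BalabanUV.Beta.GAN24.RespStepDecay (exists_respStep_decay_and_grad)
open Summit.QuantumFields.BalabanUV.Beta.GAN24.RespStepCauchy (exists_respStep_cauchy)
open Summit.QuantumFields.BalabanUV.Beta.GAN24.DressedLegEnvelope (exists_legChain_envelope)
open Summit.QuantumFields.BalabanUV.Beta.GAN24.ContactGaugeStaircaseCauchyPack (abs_gaugePieceSucc_le)
open Summit.QuantumFields.BalabanUV.Beta.GAN24.BornBorderContactNest (contact_v_eq_of_succ contact_v_eq_of_top)
open Summit.QuantumFields.BalabanUV.Beta.GAN24.BornBorderContactBound (legComp_respStep_self abs_legComp_colM_zsmul_le abs_legComp_rowMM_zsmul_le exists_legDecay_mulLegs)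
open Summit.QuantumFields.BalabanUV.Beta.GAN24.BornBorderContactPairTent (abs_legComp_colM_zsmul_sub_le abs_legComp_rowMM_zsmul_sub_le)
open Summit.QuantumFields.BalabanUV.Beta.GAN24.BornBorderContactPairLineage (abs_weight_mul_contact_v_pair_le_three)
open Summit.QuantumFields.BalabanUV.Beta.GAN24.BornLambdaDriftSup (locStencil_zero_of_locStencil locStencil_zero_iff_supBound)

namespace Summit.QuantumFields.BalabanUV.Beta.GAN24.BornBorderContactPairBound

/-! ## §2 The contact V pair letter (`d = 3`) -/

/-- [folklore] real arithmetic: **FOLDING THE THREE RATES** — `θ₁, θ₂, L ≤ Θ`, `L ≤ 1`, all in `[0, ∞)`: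
`X ≤ P·(A₁θ₁^{i+n} + A₂θ₂^{i+n})·((n+1)·L^{n+1})·E ⟹ X ≤ (P·(A₁+A₂))·(((i+n+1−i : ℕ))^1·Θ^{i+n+1})·E`. -/
theorem le_fold_rate {X P A₁ A₂ θ₁ θ₂ Θ L E : ℝ} {i n : ℕ} (hP : 0 ≤ P) (hA₁ : 0 ≤ A₁) (hA₂ : 0 ≤ A₂) (hθ₁ : 0 ≤ θ₁) (hθ₂ : 0 ≤ θ₂)
    (hL : 0 ≤ L) (h1 : θ₁ ≤ Θ) (h2 : θ₂ ≤ Θ) (hLΘ : L ≤ Θ) (hL1 : L ≤ 1) (hE : 0 ≤ E)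
    (hX : X ≤ P * (A₁ * θ₁ ^ (i + n) + A₂ * θ₂ ^ (i + n)) * ((((n : ℝ) + 1)) * L ^ (n + 1)) * E) :
    X ≤ (P * (A₁ + A₂)) * ((((i + n + 1 - i : ℕ) : ℝ)) ^ 1 * Θ ^ (i + n + 1)) * E := by
  have hΘ : 0 ≤ Θ := hL.trans hLΘ
  have hk : ((i + n + 1 - i : ℕ) : ℝ) = (n : ℝ) + 1 := by
    rw [show i + n + 1 - i = n + 1 by omega]; push_cast; ring
  rw [hk, pow_one]
  refine hX.trans ?_
  have hp1 : θ₁ ^ (i + n) ≤ Θ ^ (i + n) := pow_le_pow_left₀ hθ₁ h1 _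
  have hp2 : θ₂ ^ (i + n) ≤ Θ ^ (i + n) := pow_le_pow_left₀ hθ₂ h2 _
  have hLn : L ^ (n + 1) ≤ Θ := (pow_le_of_le_one hL hL1 (Nat.succ_ne_zero n)).trans hLΘ
  have hsum : A₁ * θ₁ ^ (i + n) + A₂ * θ₂ ^ (i + n) ≤ (A₁ + A₂) * Θ ^ (i + n) := by
    nlinarith [mul_le_mul_of_nonneg_left hp1 hA₁, mul_le_mul_of_nonneg_left hp2 hA₂]
  have hsum0 : 0 ≤ A₁ * θ₁ ^ (i + n) + A₂ * θ₂ ^ (i + n) := by positivity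
  have hn0 : (0 : ℝ) ≤ (n : ℝ) + 1 := by positivity
  calc P * (A₁ * θ₁ ^ (i + n) + A₂ * θ₂ ^ (i + n)) * ((((n : ℝ) + 1)) * L ^ (n + 1)) * E
      ≤ P * ((A₁ + A₂) * Θ ^ (i + n)) * ((((n : ℝ) + 1)) * Θ) * E := by
        gcongr
    _ = (P * (A₁ + A₂)) * (((n : ℝ) + 1) * Θ ^ (i + n + 1)) * E := by ring


section Cells

variable {Lc : ℕ} [NeZero Lc]

/-- NOT IN PRINT; OUR BOOKKEEPING ([folklore] plumbing, `d = 3`).  **THE PAIR OF TOP LINEAGES** (`n = 0`: births `i`, `i+1` in members `i+1`, `i+2`; multiplier legs `colM ∕ rowMM K̃_j Lc`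
uncomposed): (C) `abs_weight_mul_contact_v_pair_le_three` at `n = 0` with the tree letters as HYPOTHESES in their printed forms ((N1), CT-4a, the dressed envelope, the K-slot's `hK ∕ hKall`):
undressed-leg pair `c·θ₁^{i+0}` (CT-4a at `(s,k) = (i,0)`), differenced staircase pieces (Pack §A `abs_gaugePieceSucc_le`), tents `Cst·e^{δ}` ((D⁻) §1 + `legComp_respStep_self`), tent
pairs `cK·θ₂^{i}·e^{δ}` (§1). -/
theorem pair_cells_le_top (hLc : 2 ≤ Lc) {rr : Fin (3 + 1) → ℕ} (hrr : rr ∈ box (3 + 1) Lc) {cE cVH : ℝ} (hcE : |cE| ≤ (Lc : ℝ) ^ 4)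
    {C₁ κ₁ c θ₁ κ₂ KE κE Cst δ cK θ₂ : ℝ}
    (hN1 : ∀ (m k : ℕ) (μ : Fin (3 + 1)) (z : Site (3 + 1)) (l'' : Fin (3 + 1)) (w' : Site (3 + 1)),
      |respStep (d := 3) (Lc ^ m) (Lc ^ (m + k + 1)) μ z l'' w'| ≤
        C₁ * ((Lc : ℝ) ^ (5 * (k + 1)))⁻¹ * Real.exp (-(κ₁ * supNorm (quo (Lc ^ (k + 1)) w' - z))))
    (hκ₁ : 0 < κ₁) (hC₁ : 0 ≤ C₁)
    (hCau : ∀ (s k : ℕ) (μ : Fin (3 + 1)) (z : Site (3 + 1)) (l : Fin (3 + 1)) (w : Site (3 + 1)),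
      |respStep (d := 3) (Lc ^ (s + 1)) (Lc ^ (s + k + 2)) μ z l w - respStep (d := 3) (Lc ^ s) (Lc ^ (s + k + 1)) μ z l w|
        ≤ c * θ₁ ^ (s + k) * ((((Lc ^ (k + 1) : ℕ) : ℝ)) ^ (3 + 2))⁻¹ * Real.exp (-(κ₂ * supNorm (quo (Lc ^ (k + 1)) w - z))))
    (hc : 0 ≤ c) (hθ₁ : 0 ≤ θ₁) (hκ₂ : 0 < κ₂)
    (hEnv : ∀ (m k : ℕ) (μ : Fin (3 + 1)) (z : Site (3 + 1)) (κ : Fin (3 + 1)) (u : Site (3 + 1)),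
      |legChain (respStepBmSeq (d := 3) (toSite rr) Lc) m k μ z κ u| ≤ KE * ((Lc : ℝ) ^ (4 * (k + 1)))⁻¹ * Real.exp (-(κE * supNorm (quo (Lc ^ (k + 1)) u - z))))
    (hκE : 0 < κE) (hK : UnitDecayK 3 Lc (sfStep Lc) (smStep 3 Lc) Cst δ) (hKall : CauchyDecayK 3 Lc (sfStep Lc) (smStep 3 Lc) cK θ₂ δ) (hδ : 0 < δ)
    (hcK : 0 ≤ cK) (hθ₂ : 0 ≤ θ₂) (i : ℕ) (κ' : Fin (3 + 1)) (u' x z : Site (3 + 1)) (a b : Fib 3) :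
    |(cE * (Lc : ℝ) ^ (2 * (3 + 1))) ^ (0 + 1) *
        (((push₃ (-legChain (respStepBmSeq (d := 3) (toSite rr) Lc) (i + 1) 0) (colM (KStepUnit (d := 3) Lc (i + 1)) Lc) (legChain (respStepBmSeq (d := 3) (toSite rr) Lc) (i + 1) 0)
                (reslot Sum.inl Sum.inr fun κ u => cVH • vhSAt (toSite rr) 3 Lc rfl κ u) κ' u' x z a b
              - push₃ (-respStep (d := 3) (Lc ^ (i + 1)) (Lc ^ (i + 1 + 0 + 1))) (colM (KStepUnit (d := 3) Lc (i + 1)) Lc) (respStep (d := 3) (Lc ^ (i + 1)) (Lc ^ (i + 1 + 0 + 1)))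
                (reslot Sum.inl Sum.inr fun κ u => cVH • vhSAt (toSite rr) 3 Lc rfl κ u) κ' u' x z a b)
            + (push₃ (rowMM (KStepUnit (d := 3) Lc (i + 1)) Lc) (legChain (respStepBmSeq (d := 3) (toSite rr) Lc) (i + 1) 0) (legChain (respStepBmSeq (d := 3) (toSite rr) Lc) (i + 1) 0)
                (reslot Sum.inr Sum.inl fun κ u => cVH • vhSAt (toSite rr) 3 Lc rfl κ u) κ' u' x z a b
              - push₃ (rowMM (KStepUnit (d := 3) Lc (i + 1)) Lc) (respStep (d := 3) (Lc ^ (i + 1)) (Lc ^ (i + 1 + 0 + 1))) (respStep (d := 3) (Lc ^ (i + 1)) (Lc ^ (i + 1 + 0 + 1)))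
                (reslot Sum.inr Sum.inl fun κ u => cVH • vhSAt (toSite rr) 3 Lc rfl κ u) κ' u' x z a b))
          - ((push₃ (-legChain (respStepBmSeq (d := 3) (toSite rr) Lc) i 0) (colM (KStepUnit (d := 3) Lc i) Lc) (legChain (respStepBmSeq (d := 3) (toSite rr) Lc) i 0)
                (reslot Sum.inl Sum.inr fun κ u => cVH • vhSAt (toSite rr) 3 Lc rfl κ u) κ' u' x z a b
              - push₃ (-respStep (d := 3) (Lc ^ i) (Lc ^ (i + 0 + 1))) (colM (KStepUnit (d := 3) Lc i) Lc) (respStep (d := 3) (Lc ^ i) (Lc ^ (i + 0 + 1)))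
                (reslot Sum.inl Sum.inr fun κ u => cVH • vhSAt (toSite rr) 3 Lc rfl κ u) κ' u' x z a b)
            + (push₃ (rowMM (KStepUnit (d := 3) Lc i) Lc) (legChain (respStepBmSeq (d := 3) (toSite rr) Lc) i 0) (legChain (respStepBmSeq (d := 3) (toSite rr) Lc) i 0)
                (reslot Sum.inr Sum.inl fun κ u => cVH • vhSAt (toSite rr) 3 Lc rfl κ u) κ' u' x z a b
              - push₃ (rowMM (KStepUnit (d := 3) Lc i) Lc) (respStep (d := 3) (Lc ^ i) (Lc ^ (i + 0 + 1))) (respStep (d := 3) (Lc ^ i) (Lc ^ (i + 0 + 1)))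
                (reslot Sum.inr Sum.inl fun κ u => cVH • vhSAt (toSite rr) 3 Lc rfl κ u) κ' u' x z a b)))|
      ≤ |cVH| * (2 * ((Lc : ℝ) ^ 3 * (((Lc : ℝ) ^ (3 + 1))⁻¹ * (((3 : ℝ) + 1) * (Real.exp (2 * ((3 : ℝ) + 1) * min (min δ κ₁) κ₂) ^ 2 *
              (((2 * Lc : ℕ) : ℝ) ^ (3 + 1) * (((3 + 1 : ℕ) : ℝ) * ((Lc : ℝ) ^ (3 + 1) * (ell (3 + 1) Lc : ℝ))))))
            * ((2 * (Cst * Real.exp δ) * C₁ * (c * θ₁ ^ (i + 0)) + (cK * θ₂ ^ i * Real.exp δ) * C₁ ^ 2) * ((Lc : ℝ) * (32 + 288 * Lc + 512 * (Lc : ℝ) ^ 2)))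
            * Zl (3 + 1) (min (min δ κ₁) κ₂ / (4 * ((3 : ℝ) + 1))))))
          * ((((0 : ℕ) : ℝ) + 1) * ((Lc : ℝ)⁻¹) ^ (0 + 1))
          * Real.exp (-(min (min δ κ₁) κ₂ / 12 / 2 / ((3 : ℝ) + 1)) * (l1 (x - u') + l1 (z - u'))) := by
  have hCst : 0 ≤ Cst := (hK 0).nonneg (Sum.inl 0)
  have hTb : 0 ≤ Cst * Real.exp δ := by positivity
  have hE : ∀ μ z' l u, |legChain (respStepBmSeq (d := 3) (toSite rr) Lc) i 0 μ z' l u|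
      ≤ (KE * ((Lc : ℝ) ^ (4 * (0 + 1)))⁻¹) * Real.exp (-(κE * supNorm (quo (Lc ^ (0 + 1)) u - z'))) :=
    fun μ z' l u => hEnv i 0 μ z' l u
  have hEp : ∀ μ z' l u, |legChain (respStepBmSeq (d := 3) (toSite rr) Lc) (i + 1) 0 μ z' l u|
      ≤ (KE * ((Lc : ℝ) ^ (4 * (0 + 1)))⁻¹) * Real.exp (-(κE * supNorm (quo (Lc ^ (0 + 1)) u - z'))) :=
    fun μ z' l u => hEnv (i + 1) 0 μ z' l u
  have hBΔ : ∀ (μ : Fin (3 + 1)) (z : Site (3 + 1)) (l : Fin (3 + 1)) (u : Site (3 + 1)),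
      |respStep (d := 3) (Lc ^ (i + 1)) (Lc ^ (i + 1 + 0 + 1)) μ z l u - respStep (d := 3) (Lc ^ i) (Lc ^ (i + 0 + 1)) μ z l u|
        ≤ (c * θ₁ ^ (i + 0)) * ((Lc : ℝ) ^ (5 * (0 + 1)))⁻¹ * Real.exp (-(κ₂ * supNorm (quo (Lc ^ (0 + 1)) u - z))) := by
    intro μ z l u
    have h := hCau i 0 μ z l u
    rw [inv_cast_pow_pow, show i + 0 + 2 = i + 1 + 0 + 1 by ring] at h
    simpa only [mul_assoc] using h
  have hGΔ := fun (μ₀ : Fin (3 + 1)) (z₀ : Site (3 + 1)) (s : ℕ) (hs : s ≤ 0) (u : Site (3 + 1)) => abs_gaugePieceSucc_le (Lc := Lc) hCau hrr i 0 μ₀ z₀ hs u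
  obtain ⟨CK, mK, hmK, hKi⟩ := decays_KStepUnit_levels (d := 3) (Lc := Lc) i
  obtain ⟨CKp, mKp, hmKp, hKip⟩ := decays_KStepUnit_levels (d := 3) (Lc := Lc) (i + 1)
  have hcol : LegDecay (colM (KStepUnit (d := 3) Lc i) Lc) Lc CK mK := legDecay_colM hKi
  have hrow : LegDecay (rowMM (KStepUnit (d := 3) Lc i) Lc) Lc CK mK := legDecay_rowMM hKi
  have hcolp : LegDecay (colM (KStepUnit (d := 3) Lc (i + 1)) Lc) Lc CKp mKp := legDecay_colM hKip
  have hrowp : LegDecay (rowMM (KStepUnit (d := 3) Lc (i + 1)) Lc) Lc CKp mKp := legDecay_rowMM hKip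
  have hMt : ∀ (a : Fin (3 + 1)) (b : Site (3 + 1)) (μ : Fin (3 + 1)) (y : Site (3 + 1)),
      |colM (KStepUnit (d := 3) Lc i) Lc a b μ ((Lc : ℤ) • y)| ≤ Cst * Real.exp δ
        * ((((Lc : ℝ) ^ 0) ^ (2 * 3 + 1))⁻¹) * Real.exp (-(δ * supNorm (quo (Lc ^ 0) y - b))) := by
    intro a b μ y
    have h := abs_legComp_colM_zsmul_le hK hδ.le i 0 a b μ y
    simp only [Nat.add_zero, legComp_respStep_self] at h
    exact h
  have hMpt : ∀ (a : Fin (3 + 1)) (b : Site (3 + 1)) (μ : Fin (3 + 1)) (y : Site (3 + 1)),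
      |colM (KStepUnit (d := 3) Lc (i + 1)) Lc a b μ ((Lc : ℤ) • y)| ≤ Cst * Real.exp δ
        * ((((Lc : ℝ) ^ 0) ^ (2 * 3 + 1))⁻¹) * Real.exp (-(δ * supNorm (quo (Lc ^ 0) y - b))) := by
    intro a b μ y
    have h := abs_legComp_colM_zsmul_le hK hδ.le (i + 1) 0 a b μ y
    simp only [Nat.add_zero, legComp_respStep_self] at h
    exact h
  have hMΔt : ∀ (a : Fin (3 + 1)) (b : Site (3 + 1)) (μ : Fin (3 + 1)) (y : Site (3 + 1)),
      |colM (KStepUnit (d := 3) Lc (i + 1)) Lc a b μ ((Lc : ℤ) • y) - colM (KStepUnit (d := 3) Lc i) Lc a b μ ((Lc : ℤ) • y)|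
        ≤ (cK * θ₂ ^ i * Real.exp δ) * ((((Lc : ℝ) ^ 0) ^ (2 * 3 + 1))⁻¹) * Real.exp (-(δ * supNorm (quo (Lc ^ 0) y - b))) := by
    intro a b μ y
    have h := abs_legComp_colM_zsmul_sub_le hKall hδ.le hcK hθ₂ i 0 a b μ y
    simp only [Nat.add_zero, legComp_respStep_self] at h
    exact h
  have hM't : ∀ (a : Fin (3 + 1)) (b : Site (3 + 1)) (μ : Fin (3 + 1)) (y : Site (3 + 1)),
      |rowMM (KStepUnit (d := 3) Lc i) Lc a b μ ((Lc : ℤ) • y)| ≤ Cst * Real.exp δ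
        * ((((Lc : ℝ) ^ 0) ^ (2 * 3 + 1))⁻¹) * Real.exp (-(δ * supNorm (quo (Lc ^ 0) y - b))) := by
    intro a b μ y
    have h := abs_legComp_rowMM_zsmul_le hK hδ.le i 0 a b μ y
    simp only [Nat.add_zero, legComp_respStep_self] at h
    exact h
  have hM'Δt : ∀ (a : Fin (3 + 1)) (b : Site (3 + 1)) (μ : Fin (3 + 1)) (y : Site (3 + 1)),
      |rowMM (KStepUnit (d := 3) Lc (i + 1)) Lc a b μ ((Lc : ℤ) • y) - rowMM (KStepUnit (d := 3) Lc i) Lc a b μ ((Lc : ℤ) • y)|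
        ≤ (cK * θ₂ ^ i * Real.exp δ) * ((((Lc : ℝ) ^ 0) ^ (2 * 3 + 1))⁻¹) * Real.exp (-(δ * supNorm (quo (Lc ^ 0) y - b))) := by
    intro a b μ y
    have h := abs_legComp_rowMM_zsmul_sub_le hKall hδ.le hcK hθ₂ i 0 a b μ y
    simp only [Nat.add_zero, legComp_respStep_self] at h
    exact h
  exact abs_weight_mul_contact_v_pair_le_three (cVH := cVH) (i := i) (n := 0) hLc hrr hcE hN1 hκ₁ hC₁ hκ₂ (by positivity : 0 ≤ c * θ₁ ^ (i + 0)) hBΔ hGΔ hE hEp hκE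
    (hcol.summable hmK) (hcolp.summable hmKp) hMt hMpt hMΔt (fun a b μ z => hrow.abs_le hmK.le a b μ z) (hrow.summable hmK)
    (fun a b μ z => hrowp.abs_le hmKp.le a b μ z) (hrowp.summable hmKp) hM't hM'Δt hδ hTb (by positivity) κ' u' x z a b

/-- NOT IN PRINT; OUR BOOKKEEPING ([folklore] plumbing, `d = 3`).  **THE PAIR OF NESTED LINEAGES** (`n = m+1`: composite multiplier legs `legComp (colM ∕ rowMM K̃_j Lc) (respStep …)`):
(C) at `n = m+1` with the tree letters as HYPOTHESES in their printed forms; tents ((D⁻) §1 `abs_legComp_colM∕rowMM_zsmul_le`), tent pairs (§1), localisation by (D⁻) §1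
`exists_legDecay_mulLegs` at births `i`, `i+1`. -/
theorem pair_cells_le_succ (hLc : 2 ≤ Lc) {rr : Fin (3 + 1) → ℕ} (hrr : rr ∈ box (3 + 1) Lc) {cE cVH : ℝ} (hcE : |cE| ≤ (Lc : ℝ) ^ 4)
    {C₁ κ₁ c θ₁ κ₂ KE κE Cst δ cK θ₂ : ℝ}
    (hN1 : ∀ (m k : ℕ) (μ : Fin (3 + 1)) (z : Site (3 + 1)) (l'' : Fin (3 + 1)) (w' : Site (3 + 1)),
      |respStep (d := 3) (Lc ^ m) (Lc ^ (m + k + 1)) μ z l'' w'| ≤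
        C₁ * ((Lc : ℝ) ^ (5 * (k + 1)))⁻¹ * Real.exp (-(κ₁ * supNorm (quo (Lc ^ (k + 1)) w' - z))))
    (hκ₁ : 0 < κ₁) (hC₁ : 0 ≤ C₁)
    (hCau : ∀ (s k : ℕ) (μ : Fin (3 + 1)) (z : Site (3 + 1)) (l : Fin (3 + 1)) (w : Site (3 + 1)),
      |respStep (d := 3) (Lc ^ (s + 1)) (Lc ^ (s + k + 2)) μ z l w - respStep (d := 3) (Lc ^ s) (Lc ^ (s + k + 1)) μ z l w|
        ≤ c * θ₁ ^ (s + k) * ((((Lc ^ (k + 1) : ℕ) : ℝ)) ^ (3 + 2))⁻¹ * Real.exp (-(κ₂ * supNorm (quo (Lc ^ (k + 1)) w - z))))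
    (hc : 0 ≤ c) (hθ₁ : 0 ≤ θ₁) (hκ₂ : 0 < κ₂)
    (hEnv : ∀ (m k : ℕ) (μ : Fin (3 + 1)) (z : Site (3 + 1)) (κ : Fin (3 + 1)) (u : Site (3 + 1)),
      |legChain (respStepBmSeq (d := 3) (toSite rr) Lc) m k μ z κ u| ≤ KE * ((Lc : ℝ) ^ (4 * (k + 1)))⁻¹ * Real.exp (-(κE * supNorm (quo (Lc ^ (k + 1)) u - z))))
    (hκE : 0 < κE) (hK : UnitDecayK 3 Lc (sfStep Lc) (smStep 3 Lc) Cst δ) (hKall : CauchyDecayK 3 Lc (sfStep Lc) (smStep 3 Lc) cK θ₂ δ) (hδ : 0 < δ)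
    (hcK : 0 ≤ cK) (hθ₂ : 0 ≤ θ₂) (i m : ℕ) (κ' : Fin (3 + 1)) (u' x z : Site (3 + 1)) (a b : Fib 3) :
    |(cE * (Lc : ℝ) ^ (2 * (3 + 1))) ^ ((m + 1) + 1) *
        (((push₃ (-legChain (respStepBmSeq (d := 3) (toSite rr) Lc) (i + 1) (m + 1)) (legComp (colM (KStepUnit (d := 3) Lc (i + 1)) Lc) (respStep (d := 3) (Lc ^ (i + 1 + 1)) (Lc ^ (i + 1 + (m + 1) + 1)))) (legChain (respStepBmSeq (d := 3) (toSite rr) Lc) (i + 1) (m + 1))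
                (reslot Sum.inl Sum.inr fun κ u => cVH • vhSAt (toSite rr) 3 Lc rfl κ u) κ' u' x z a b
              - push₃ (-respStep (d := 3) (Lc ^ (i + 1)) (Lc ^ (i + 1 + (m + 1) + 1))) (legComp (colM (KStepUnit (d := 3) Lc (i + 1)) Lc) (respStep (d := 3) (Lc ^ (i + 1 + 1)) (Lc ^ (i + 1 + (m + 1) + 1)))) (respStep (d := 3) (Lc ^ (i + 1)) (Lc ^ (i + 1 + (m + 1) + 1)))
                (reslot Sum.inl Sum.inr fun κ u => cVH • vhSAt (toSite rr) 3 Lc rfl κ u) κ' u' x z a b)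
            + (push₃ (legComp (rowMM (KStepUnit (d := 3) Lc (i + 1)) Lc) (respStep (d := 3) (Lc ^ (i + 1 + 1)) (Lc ^ (i + 1 + (m + 1) + 1)))) (legChain (respStepBmSeq (d := 3) (toSite rr) Lc) (i + 1) (m + 1)) (legChain (respStepBmSeq (d := 3) (toSite rr) Lc) (i + 1) (m + 1))
                (reslot Sum.inr Sum.inl fun κ u => cVH • vhSAt (toSite rr) 3 Lc rfl κ u) κ' u' x z a b
              - push₃ (legComp (rowMM (KStepUnit (d := 3) Lc (i + 1)) Lc) (respStep (d := 3) (Lc ^ (i + 1 + 1)) (Lc ^ (i + 1 + (m + 1) + 1)))) (respStep (d := 3) (Lc ^ (i + 1)) (Lc ^ (i + 1 + (m + 1) + 1))) (respStep (d := 3) (Lc ^ (i + 1)) (Lc ^ (i + 1 + (m + 1) + 1)))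
                (reslot Sum.inr Sum.inl fun κ u => cVH • vhSAt (toSite rr) 3 Lc rfl κ u) κ' u' x z a b))
          - ((push₃ (-legChain (respStepBmSeq (d := 3) (toSite rr) Lc) i (m + 1)) (legComp (colM (KStepUnit (d := 3) Lc i) Lc) (respStep (d := 3) (Lc ^ (i + 1)) (Lc ^ (i + (m + 1) + 1)))) (legChain (respStepBmSeq (d := 3) (toSite rr) Lc) i (m + 1))
                (reslot Sum.inl Sum.inr fun κ u => cVH • vhSAt (toSite rr) 3 Lc rfl κ u) κ' u' x z a b
              - push₃ (-respStep (d := 3) (Lc ^ i) (Lc ^ (i + (m + 1) + 1))) (legComp (colM (KStepUnit (d := 3) Lc i) Lc) (respStep (d := 3) (Lc ^ (i + 1)) (Lc ^ (i + (m + 1) + 1)))) (respStep (d := 3) (Lc ^ i) (Lc ^ (i + (m + 1) + 1)))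
                (reslot Sum.inl Sum.inr fun κ u => cVH • vhSAt (toSite rr) 3 Lc rfl κ u) κ' u' x z a b)
            + (push₃ (legComp (rowMM (KStepUnit (d := 3) Lc i) Lc) (respStep (d := 3) (Lc ^ (i + 1)) (Lc ^ (i + (m + 1) + 1)))) (legChain (respStepBmSeq (d := 3) (toSite rr) Lc) i (m + 1)) (legChain (respStepBmSeq (d := 3) (toSite rr) Lc) i (m + 1))
                (reslot Sum.inr Sum.inl fun κ u => cVH • vhSAt (toSite rr) 3 Lc rfl κ u) κ' u' x z a b
              - push₃ (legComp (rowMM (KStepUnit (d := 3) Lc i) Lc) (respStep (d := 3) (Lc ^ (i + 1)) (Lc ^ (i + (m + 1) + 1)))) (respStep (d := 3) (Lc ^ i) (Lc ^ (i + (m + 1) + 1))) (respStep (d := 3) (Lc ^ i) (Lc ^ (i + (m + 1) + 1)))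
                (reslot Sum.inr Sum.inl fun κ u => cVH • vhSAt (toSite rr) 3 Lc rfl κ u) κ' u' x z a b)))|
      ≤ |cVH| * (2 * ((Lc : ℝ) ^ 3 * (((Lc : ℝ) ^ (3 + 1))⁻¹ * (((3 : ℝ) + 1) * (Real.exp (2 * ((3 : ℝ) + 1) * min (min δ κ₁) κ₂) ^ 2 *
              (((2 * Lc : ℕ) : ℝ) ^ (3 + 1) * (((3 + 1 : ℕ) : ℝ) * ((Lc : ℝ) ^ (3 + 1) * (ell (3 + 1) Lc : ℝ))))))
            * ((2 * (Cst * Real.exp δ) * C₁ * (c * θ₁ ^ (i + (m + 1))) + (cK * θ₂ ^ (i + (m + 1)) * Real.exp δ) * C₁ ^ 2) * ((Lc : ℝ) * (32 + 288 * Lc + 512 * (Lc : ℝ) ^ 2)))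
            * Zl (3 + 1) (min (min δ κ₁) κ₂ / (4 * ((3 : ℝ) + 1))))))
          * (((((m + 1) : ℕ) : ℝ) + 1) * ((Lc : ℝ)⁻¹) ^ ((m + 1) + 1))
          * Real.exp (-(min (min δ κ₁) κ₂ / 12 / 2 / ((3 : ℝ) + 1)) * (l1 (x - u') + l1 (z - u'))) := by
  have hCst : 0 ≤ Cst := (hK 0).nonneg (Sum.inl 0)
  have hTb : 0 ≤ Cst * Real.exp δ := by positivity
  have hE : ∀ μ z' l u, |legChain (respStepBmSeq (d := 3) (toSite rr) Lc) i (m + 1) μ z' l u|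
      ≤ (KE * ((Lc : ℝ) ^ (4 * (m + 1 + 1)))⁻¹) * Real.exp (-(κE * supNorm (quo (Lc ^ (m + 1 + 1)) u - z'))) :=
    fun μ z' l u => hEnv i (m + 1) μ z' l u
  have hEp : ∀ μ z' l u, |legChain (respStepBmSeq (d := 3) (toSite rr) Lc) (i + 1) (m + 1) μ z' l u|
      ≤ (KE * ((Lc : ℝ) ^ (4 * (m + 1 + 1)))⁻¹) * Real.exp (-(κE * supNorm (quo (Lc ^ (m + 1 + 1)) u - z'))) :=
    fun μ z' l u => hEnv (i + 1) (m + 1) μ z' l u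
  have hBΔ : ∀ (μ : Fin (3 + 1)) (z : Site (3 + 1)) (l : Fin (3 + 1)) (u : Site (3 + 1)),
      |respStep (d := 3) (Lc ^ (i + 1)) (Lc ^ (i + 1 + (m + 1) + 1)) μ z l u - respStep (d := 3) (Lc ^ i) (Lc ^ (i + (m + 1) + 1)) μ z l u|
        ≤ (c * θ₁ ^ (i + (m + 1))) * ((Lc : ℝ) ^ (5 * (m + 1 + 1)))⁻¹ * Real.exp (-(κ₂ * supNorm (quo (Lc ^ (m + 1 + 1)) u - z))) := by
    intro μ z l u
    have h := hCau i (m + 1) μ z l u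
    rw [inv_cast_pow_pow, show i + (m + 1) + 2 = i + 1 + (m + 1) + 1 by ring] at h
    simpa only [mul_assoc] using h
  have hGΔ := fun (μ₀ : Fin (3 + 1)) (z₀ : Site (3 + 1)) (s : ℕ) (hs : s ≤ m + 1) (u : Site (3 + 1)) =>
    abs_gaugePieceSucc_le (Lc := Lc) hCau hrr i (m + 1) μ₀ z₀ hs u
  obtain ⟨N, CM, mM, hmM, hcol, hrow⟩ := exists_legDecay_mulLegs (d := 3) (Lc := Lc) i (m + 1)
  obtain ⟨Np, CMp, mMp, hmMp, hcolp, hrowp⟩ := exists_legDecay_mulLegs (d := 3) (Lc := Lc) (i + 1) (m + 1)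
  have hMt := fun (a : Fin (3 + 1)) (b : Site (3 + 1)) (μ : Fin (3 + 1)) (y : Site (3 + 1)) => abs_legComp_colM_zsmul_le hK hδ.le i (m + 1) a b μ y
  have hMpt := fun (a : Fin (3 + 1)) (b : Site (3 + 1)) (μ : Fin (3 + 1)) (y : Site (3 + 1)) => abs_legComp_colM_zsmul_le hK hδ.le (i + 1) (m + 1) a b μ y
  have hMΔt := fun (a : Fin (3 + 1)) (b : Site (3 + 1)) (μ : Fin (3 + 1)) (y : Site (3 + 1)) =>
    abs_legComp_colM_zsmul_sub_le hKall hδ.le hcK hθ₂ i (m + 1) a b μ y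
  have hM't := fun (a : Fin (3 + 1)) (b : Site (3 + 1)) (μ : Fin (3 + 1)) (y : Site (3 + 1)) => abs_legComp_rowMM_zsmul_le hK hδ.le i (m + 1) a b μ y
  have hM'Δt := fun (a : Fin (3 + 1)) (b : Site (3 + 1)) (μ : Fin (3 + 1)) (y : Site (3 + 1)) =>
    abs_legComp_rowMM_zsmul_sub_le hKall hδ.le hcK hθ₂ i (m + 1) a b μ y
  exact abs_weight_mul_contact_v_pair_le_three (cVH := cVH) (i := i) (n := m + 1) hLc hrr hcE hN1 hκ₁ hC₁ hκ₂ (by positivity : 0 ≤ c * θ₁ ^ (i + (m + 1))) hBΔ hGΔ hE hEp hκE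
    (hcol.summable hmM) (hcolp.summable hmMp) hMt hMpt hMΔt (fun a b μ z => hrow.abs_le hmM.le a b μ z) (hrow.summable hmM)
    (fun a b μ z => hrowp.abs_le hmMp.le a b μ z) (hrowp.summable hmMp) hM't hM'Δt hδ hTb (by positivity) κ' u' x z a b

end Cells

section Three

variable {Lc : ℕ} [NeZero Lc]

/-- NOT IN PRINT; OUR PROOF ATTEMPT of the V twin of leaf-01 g61's BORN-CONTACT-DIFF-PLAN v0, ASSEMBLED («(V-C)-DIFF» END).  **THE CONTACT V PAIR LETTER OF THE BORN-V RATE HALF** (`d = 3`,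
`2 ≤ Lc`): at the pin `|cE| ≤ Lc^4` and for every scale `cVH` there are `C ≥ 0`, `0 ≤ Θ < 1`, `δ > 0` such that for EVERY in-block root `rr ∈ box (3+1) Lc` and EVERY `i < k`,
`LocStencil ((D_{i+1,k+1} − U_{i+1,k+1}) − (D_{i,k} − U_{i,k})) (C·(((k−i:ℕ):ℝ)^1·Θ^k)) δ` — the lower member is the display of `BornBorderContactBound.exists_hCgV_three` VERBATIM, the upper member
the same under `i ↦ i+1` with the transport length `k−1−i` and the weight exponent `k−i` unchanged (= leaf-04 g57's pair display).  Per lineage `k = i+n+1`: (C1) for both members, then (C)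
`abs_weight_mul_contact_v_pair_le_three` with the tree letters: (N1) `exists_respStep_decay_and_grad`, CT-4a `exists_respStep_cauchy` (undressed-leg pair `c_Δ = c·θ₁^{i+n}`; the
differenced staircase by Pack §A `abs_gaugePieceSucc_le`), `exists_legChain_envelope` at births `i`, `i+1`, the K-slot's `convCKWall_holds` (tents via (D⁻) §1, tent pairs via §1:
`T_Δ = cK·θ₂^{i+n}·e^{δ}`), and `le_fold_rate` (`Θ = max (max θ₁ θ₂) Lc⁻¹`; rate `min (min δ κ₁) κ₂ ∕ 96`). -/
theorem exists_hCgV_pair_three (hLc : 2 ≤ Lc) (cE cVH : ℝ) (hcE : |cE| ≤ (Lc : ℝ) ^ 4) :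
    ∃ C Θ δ : ℝ, 0 ≤ C ∧ 0 ≤ Θ ∧ Θ < 1 ∧ 0 < δ ∧ ∀ (rr : Fin (3 + 1) → ℕ), rr ∈ box (3 + 1) Lc → ∀ k i : ℕ, i < k →
      LocStencil
        ((transport (unitStepMap Lc (toSite rr) cE) (i + 1 + 1) (k - 1 - i)
            (unitStepMap Lc (toSite rr) cE (i + 1) (fun κ u => cVH • vhSAt (toSite rr) 3 Lc rfl κ u))
          - fun κ' u' => (cE * (Lc : ℝ) ^ (2 * (3 + 1))) ^ (k - i) •
            push₃ (respStep (d := 3) (Lc ^ (i + 1 + 1)) (Lc ^ (k + 1))) (respStep (d := 3) (Lc ^ (i + 1 + 1)) (Lc ^ (k + 1)))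
              (respStep (d := 3) (Lc ^ (i + 1 + 1)) (Lc ^ (k + 1)))
              (fun κ u => -(push₃ (-respStep (d := 3) (Lc ^ (i + 1)) (Lc ^ (i + 1 + 1))) (colM (KStepUnit (d := 3) Lc (i + 1)) Lc)
                    (respStep (d := 3) (Lc ^ (i + 1)) (Lc ^ (i + 1 + 1))) (reslot Sum.inl Sum.inr fun κ u => cVH • vhSAt (toSite rr) 3 Lc rfl κ u) κ u
                + push₃ (rowMM (KStepUnit (d := 3) Lc (i + 1)) Lc) (respStep (d := 3) (Lc ^ (i + 1)) (Lc ^ (i + 1 + 1)))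
                    (respStep (d := 3) (Lc ^ (i + 1)) (Lc ^ (i + 1 + 1))) (reslot Sum.inr Sum.inl fun κ u => cVH • vhSAt (toSite rr) 3 Lc rfl κ u) κ u)) κ' u')
        - (transport (unitStepMap Lc (toSite rr) cE) (i + 1) (k - 1 - i)
            (unitStepMap Lc (toSite rr) cE i (fun κ u => cVH • vhSAt (toSite rr) 3 Lc rfl κ u))
          - fun κ' u' => (cE * (Lc : ℝ) ^ (2 * (3 + 1))) ^ (k - i) •
            push₃ (respStep (d := 3) (Lc ^ (i + 1)) (Lc ^ k)) (respStep (d := 3) (Lc ^ (i + 1)) (Lc ^ k)) (respStep (d := 3) (Lc ^ (i + 1)) (Lc ^ k))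
              (fun κ u => -(push₃ (-respStep (d := 3) (Lc ^ i) (Lc ^ (i + 1))) (colM (KStepUnit (d := 3) Lc i) Lc)
                    (respStep (d := 3) (Lc ^ i) (Lc ^ (i + 1))) (reslot Sum.inl Sum.inr fun κ u => cVH • vhSAt (toSite rr) 3 Lc rfl κ u) κ u
                + push₃ (rowMM (KStepUnit (d := 3) Lc i) Lc) (respStep (d := 3) (Lc ^ i) (Lc ^ (i + 1)))
                    (respStep (d := 3) (Lc ^ i) (Lc ^ (i + 1))) (reslot Sum.inr Sum.inl fun κ u => cVH • vhSAt (toSite rr) 3 Lc rfl κ u) κ u)) κ' u'))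
        (C * (((k - i : ℕ) : ℝ) ^ 1 * Θ ^ k)) δ := by
  have hLc1 : 1 ≤ Lc := le_trans (by norm_num) hLc
  have hL : (0 : ℝ) < (Lc : ℝ) := Nat.cast_pos.2 (Nat.pos_of_ne_zero (NeZero.ne Lc))
  -- the tree letters, constants outside every ∀
  obtain ⟨κ₁, C₁, -, hκ₁, hC₁, -, hN1raw, -⟩ := exists_respStep_decay_and_grad (Lc := Lc)
  have hN1 : ∀ (m k : ℕ) (μ : Fin (3 + 1)) (z : Site (3 + 1)) (l'' : Fin (3 + 1)) (w' : Site (3 + 1)),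
      |respStep (d := 3) (Lc ^ m) (Lc ^ (m + k + 1)) μ z l'' w'| ≤
        C₁ * ((Lc : ℝ) ^ (5 * (k + 1)))⁻¹ * Real.exp (-(κ₁ * supNorm (quo (Lc ^ (k + 1)) w' - z))) := by
    intro m k μ z l'' w'
    have h := hN1raw m k μ z l'' w'
    rwa [inv_cast_pow_pow] at h
  obtain ⟨c, θ₁, κ₂, hc, hθ₁, hθ₁1, hκ₂, hCau⟩ := exists_respStep_cauchy (Lc := Lc) hLc
  obtain ⟨κE, KE, hκE, -, hEnv⟩ := exists_legChain_envelope (Lc := Lc) hLc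
  obtain ⟨Cst, δ, cK, θ₂, hδ, hθ₂, hθ₂1, hK, hKall⟩ := convCKWall_holds (Lc := Lc) hLc
  have hCst : 0 ≤ Cst := (hK 0).nonneg (Sum.inl 0)
  have hcK : 0 ≤ cK := by simpa only [pow_zero, mul_one] using (hKall 0 0).nonneg (Sum.inl 0)
  have hTb : 0 ≤ Cst * Real.exp δ := by positivity
  set κ : ℝ := min (min δ κ₁) κ₂ with hκdef
  have hκ : 0 < κ := lt_min (lt_min hδ hκ₁) hκ₂
  set Θ : ℝ := max (max θ₁ θ₂) (Lc : ℝ)⁻¹ with hΘdef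
  have hΘ0 : 0 ≤ Θ := hθ₁.trans ((le_max_left _ _).trans (le_max_left _ _))
  have hΘ1 : Θ < 1 := by
    refine max_lt (max_lt hθ₁1 hθ₂1) ?_
    have h2 : (2 : ℝ) ≤ Lc := by exact_mod_cast hLc
    rw [inv_lt_one_iff₀]; right; linarith
  have hZ : 0 ≤ Zl (3 + 1) (κ / (4 * ((3 : ℝ) + 1))) := Zl_nonneg (by positivity)
  refine ⟨|cVH| * (2 * ((Lc : ℝ) ^ 3 * (((Lc : ℝ) ^ (3 + 1))⁻¹ * (((3 : ℝ) + 1) * (Real.exp (2 * ((3 : ℝ) + 1) * κ) ^ 2 *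
              (((2 * Lc : ℕ) : ℝ) ^ (3 + 1) * (((3 + 1 : ℕ) : ℝ) * ((Lc : ℝ) ^ (3 + 1) * (ell (3 + 1) Lc : ℝ))))))
            * ((Lc : ℝ) * (32 + 288 * Lc + 512 * (Lc : ℝ) ^ 2)) * Zl (3 + 1) (κ / (4 * ((3 : ℝ) + 1))))))
          * (2 * (Cst * Real.exp δ) * C₁ * c + (cK * Real.exp δ) * C₁ ^ 2),
    Θ, κ / 12 / 2 / ((3 : ℝ) + 1), by positivity, hΘ0, hΘ1, by positivity, ?_⟩
  intro rr hrr k i hik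
  obtain ⟨n, rfl⟩ : ∃ n, k = i + n + 1 := ⟨k - i - 1, by omega⟩
  intro κ' u'
  simp only [Pi.sub_apply]
  cases n with
  | zero =>
    have hup := contact_v_eq_of_top hrr cE cVH (i := i + 1) (k := i + 0 + 1 + 1) (by omega) κ' u'
    rw [show i + 0 + 1 + 1 - 1 - (i + 1) = i + 0 + 1 - 1 - i by omega, show i + 0 + 1 + 1 - (i + 1) = i + 0 + 1 - i by omega] at hup
    rw [hup, contact_v_eq_of_top hrr cE cVH (i := i) (k := i + 0 + 1) rfl κ' u']
    intro x z a b
    simp only [Pi.neg_apply, Pi.smul_apply, Pi.add_apply, Pi.sub_apply, smul_eq_mul]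
    rw [neg_sub_neg, abs_sub_comm, ← mul_sub]
    have H := pair_cells_le_top (cVH := cVH) hLc hrr hcE hN1 hκ₁ hC₁ hCau hc hθ₁ hκ₂ (hEnv rr hrr) hκE hK hKall hδ hcK hθ₂ i κ' u' x z a b
    refine le_fold_rate (i := i) (n := 0) (θ₁ := θ₁) (θ₂ := θ₂) (L := (Lc : ℝ)⁻¹) (by positivity) (by positivity) (by positivity) hθ₁ hθ₂ (inv_pos.2 hL).le
      ((le_max_left _ _).trans (le_max_left _ _)) ((le_max_right _ _).trans (le_max_left _ _)) (le_max_right _ _)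
      (inv_le_one_of_one_le₀ (by exact_mod_cast hLc1)) (Real.exp_pos _).le (H.trans (le_of_eq ?_))
    ring
  | succ m =>
    have hup := contact_v_eq_of_succ hLc hrr cE cVH (i := i + 1) (m := m) (k := i + (m + 1) + 1 + 1) (by omega) κ' u'
    rw [show i + (m + 1) + 1 + 1 - 1 - (i + 1) = i + (m + 1) + 1 - 1 - i by omega,
      show i + (m + 1) + 1 + 1 - (i + 1) = i + (m + 1) + 1 - i by omega] at hup
    rw [hup, contact_v_eq_of_succ hLc hrr cE cVH (i := i) (m := m) (k := i + (m + 1) + 1) rfl κ' u']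
    intro x z a b
    simp only [Pi.neg_apply, Pi.smul_apply, Pi.add_apply, Pi.sub_apply, smul_eq_mul]
    rw [neg_sub_neg, abs_sub_comm, ← mul_sub]
    have H := pair_cells_le_succ (cVH := cVH) hLc hrr hcE hN1 hκ₁ hC₁ hCau hc hθ₁ hκ₂ (hEnv rr hrr) hκE hK hKall hδ hcK hθ₂ i m κ' u' x z a b
    refine le_fold_rate (i := i) (n := m + 1) (θ₁ := θ₁) (θ₂ := θ₂) (L := (Lc : ℝ)⁻¹) (by positivity) (by positivity) (by positivity) hθ₁ hθ₂ (inv_pos.2 hL).le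
      ((le_max_left _ _).trans (le_max_left _ _)) ((le_max_right _ _).trans (le_max_left _ _)) (le_max_right _ _)
      (inv_le_one_of_one_le₀ (by exact_mod_cast hLc1)) (Real.exp_pos _).le (H.trans (le_of_eq ?_))
    ring

/-! ## §3 Docking: leaf-04 g57's `hPcV` binder (sup currency, births `≥ 1`, `q = 1`) -/

/-- NOT IN PRINT; OUR BOOKKEEPING («(V-C)-DIFF» docked; [folklore] once §2 is given).  **leaf-04 g57's `hPcV` BINDER OF `BornBorderDriftAssembly.exists_hBdevV_three_of_contactPairs` AT `q = 1`,
VERBATIM** (`d = 3`, `2 ≤ Lc`, pin `cE = Lc^(3+1)`, every `cVH`): the top-aligned CONTACT V pairs with births `i ≥ 1` are entrywise `≤ CPc·((k−i)^1·Θc^k)`, uniformly in the in-block root —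
§2 with the decay forgotten (`locStencil_zero_of_locStencil`, `locStencil_zero_iff_supBound`) and the pin bridged by one `rw` (the OWNER's `abs_cE_le` pattern). -/
theorem exists_hPcV_three (hLc : 2 ≤ Lc) {cE : ℝ} (hcE : cE = (Lc : ℝ) ^ (3 + 1)) (cVH : ℝ) :
    ∃ CPc Θc : ℝ, 0 ≤ CPc ∧ 0 ≤ Θc ∧ Θc < 1 ∧ ∀ (rr : Fin (3 + 1) → ℕ), rr ∈ box (3 + 1) Lc → ∀ k i : ℕ, 1 ≤ i → i < k → ∀ κ u,
      SupBound
        (((transport (unitStepMap Lc (toSite rr) cE) (i + 1 + 1) (k - 1 - i)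
            (unitStepMap Lc (toSite rr) cE (i + 1) (fun κ u => cVH • vhSAt (toSite rr) 3 Lc rfl κ u))
          - fun κ' u' => (cE * (Lc : ℝ) ^ (2 * (3 + 1))) ^ (k - i) •
            push₃ (respStep (d := 3) (Lc ^ (i + 1 + 1)) (Lc ^ (k + 1))) (respStep (d := 3) (Lc ^ (i + 1 + 1)) (Lc ^ (k + 1)))
              (respStep (d := 3) (Lc ^ (i + 1 + 1)) (Lc ^ (k + 1)))
              (fun κ u => -(push₃ (-respStep (d := 3) (Lc ^ (i + 1)) (Lc ^ (i + 1 + 1))) (colM (KStepUnit (d := 3) Lc (i + 1)) Lc)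
                    (respStep (d := 3) (Lc ^ (i + 1)) (Lc ^ (i + 1 + 1))) (reslot Sum.inl Sum.inr fun κ u => cVH • vhSAt (toSite rr) 3 Lc rfl κ u) κ u
                + push₃ (rowMM (KStepUnit (d := 3) Lc (i + 1)) Lc) (respStep (d := 3) (Lc ^ (i + 1)) (Lc ^ (i + 1 + 1)))
                    (respStep (d := 3) (Lc ^ (i + 1)) (Lc ^ (i + 1 + 1))) (reslot Sum.inr Sum.inl fun κ u => cVH • vhSAt (toSite rr) 3 Lc rfl κ u) κ u)) κ' u')
        - (transport (unitStepMap Lc (toSite rr) cE) (i + 1) (k - 1 - i)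
            (unitStepMap Lc (toSite rr) cE i (fun κ u => cVH • vhSAt (toSite rr) 3 Lc rfl κ u))
          - fun κ' u' => (cE * (Lc : ℝ) ^ (2 * (3 + 1))) ^ (k - i) •
            push₃ (respStep (d := 3) (Lc ^ (i + 1)) (Lc ^ k)) (respStep (d := 3) (Lc ^ (i + 1)) (Lc ^ k)) (respStep (d := 3) (Lc ^ (i + 1)) (Lc ^ k))
              (fun κ u => -(push₃ (-respStep (d := 3) (Lc ^ i) (Lc ^ (i + 1))) (colM (KStepUnit (d := 3) Lc i) Lc)
                    (respStep (d := 3) (Lc ^ i) (Lc ^ (i + 1))) (reslot Sum.inl Sum.inr fun κ u => cVH • vhSAt (toSite rr) 3 Lc rfl κ u) κ u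
                + push₃ (rowMM (KStepUnit (d := 3) Lc i) Lc) (respStep (d := 3) (Lc ^ i) (Lc ^ (i + 1)))
                    (respStep (d := 3) (Lc ^ i) (Lc ^ (i + 1))) (reslot Sum.inr Sum.inl fun κ u => cVH • vhSAt (toSite rr) 3 Lc rfl κ u) κ u)) κ' u')) κ u)
        (CPc * ((((k - i : ℕ) : ℝ)) ^ 1 * Θc ^ k)) := by
  have habs : |cE| ≤ (Lc : ℝ) ^ 4 := by rw [hcE, abs_of_nonneg (by positivity)]
  obtain ⟨C, Θ, δ, hC, hΘ0, hΘ1, hδ, h⟩ := exists_hCgV_pair_three hLc cE cVH habs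
  refine ⟨C, Θ, hC, hΘ0, hΘ1, fun rr hrr k i _ hik => ?_⟩
  exact locStencil_zero_iff_supBound.1 (locStencil_zero_of_locStencil (h rr hrr k i hik) hδ.le)

end Three

end Summit.QuantumFields.BalabanUV.Beta.GAN24.BornBorderContactPairBound
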